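import Summits.CriticalPhenomena.PercolationContinuityZ3.Theorems.PercNearOneGluingNoHeavyLowerTailUpwardTransportSingletonsPacking
import HarnessLib

/-!
# `NoHeavyLowerTail` (stmt-CriticalPhenomena-4575) — UT for SINGLETON POCKETS: the lonely-observer inequality
# holds on every up-set of the observer's cluster (all `|A|`, all levels)

Lemma factory #6 (`prim-lf-6`, gen 2).  `μ = prodBernoulli w` on `Fin n`, relays `A`, observer `o`, level `j ≥ 1`,
`π(v) = {z ∈ A : v ↔ z}`, `N_v = |π(v)|`, champion `c ∈ A` (`μ(N_a ≤ j) ≤ μ(N_c ≤ j)` for all `a ∈ A`), and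
`C_o = openEdgeCluster ω o`.  For EVERY up-set `𝒰` of edge sets,

  `μ(C_o ∈ 𝒰, N_o = 1, N_c ≥ j+1) ≤ μ(C_o ∈ 𝒰, N_o ≥ j+1, o ↮ c)`        (`lonelyObserver_le_bigBlock_upset`).

With `𝒰 = univ` this is `Theorems.lonelyObserver_le_bigBlock` (prim-gen-swap); the up-set version is the
singleton-pocket face of the upward-transport statement UT (`Theorems.noHeavyLowerTail_of_upwardTransport`,
memo `run/shared/lean/prim/prim-lf-6/CANDIDATES.md` §B3.1; ttrl2 census `run/shared/lean/ttrl/lf6/UT.md`: 0 violations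
in 24.6 M exact instances): by Strassen's theorem it says that the mass of singleton pockets `{x}` of `o` seen while the
champion is heavy is transported UPWARD in the cluster lattice onto heavy pockets of `o` avoiding `c`.  Hence UT is a
theorem in every cell `|A| ≤ j + 2` (there all bad pockets are singletons), exactly as TCS/CST.
Proof: the packing `UTSingletons.packing_upset` (`…UpwardTransportSingletonsPacking.lean`) over all big targets
`T ⊆ A ∖ c` and the champion rows, word for word as in `…LonelyObserver.lean`.  No definitions, no named facts, no sorries.
-/

noncomputable section

namespace Summit.CriticalPhenomena.PercolationContinuityZ3.Theorems

open scoped BigOperators Classical Topology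
open MeasureTheory Set Filter
open Literature.Probability.LatticeModels (prodBernoulli)
open Literature.Probability.Percolation
open BlockLonelyRelay GuardedBlockLonelyRelay AttachedChampionLevelOne LonelyObserver

variable {n : ℕ}

open UTSingletons in
/-- **UT for singleton pockets — the lonely-observer inequality on every up-set of the observer's cluster** (all `|A|`,
all levels `j ≥ 1`).  For a champion `c ∈ A` at level `j` and every up-set `𝒰` of edge sets,

  `μ(C_o ∈ 𝒰, |π(o)| = 1, |π(c)| ≥ j+1) ≤ μ(C_o ∈ 𝒰, |π(o)| ≥ j+1, o ↮ c)`.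

`𝒰 = univ` is `Theorems.lonelyObserver_le_bigBlock`; by Strassen's theorem the family of all up-sets says that the singleton-pocket
mass is transported UPWARD in the cluster lattice onto heavy pockets avoiding the champion (the singleton face of UT,
`Theorems.noHeavyLowerTail_of_upwardTransport`).  Proof: the packing `UTSingletons.packing_upset` over all big targets
`T ⊆ A ∖ c` with the champion rows, word for word as in `…LonelyObserver.lean`. -/
theorem lonelyObserver_le_bigBlock_upset (w : Sym2 (Fin n) → unitInterval) (A : Finset (Fin n)) (o c : Fin n)
    (j : ℕ) (hj : 1 ≤ j) (hc : c ∈ A)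
    (hmax : ∀ a ∈ A,
      (prodBernoulli w).real {ω : BondConfig (Fin n) | (A.filter fun z => ω ∈ openConn a z).card ≤ j} ≤
        (prodBernoulli w).real {ω : BondConfig (Fin n) | (A.filter fun z => ω ∈ openConn c z).card ≤ j})
    (U : Set (Set (Sym2 (Fin n)))) (hU : IsUpperSet U) :
    (prodBernoulli w).real ({ω : BondConfig (Fin n) | openEdgeCluster ω o ∈ U} ∩
        {ω | (A.filter fun z => ω ∈ openConn o z).card = 1 ∧ j + 1 ≤ (A.filter fun z => ω ∈ openConn c z).card}) ≤
      (prodBernoulli w).real ({ω : BondConfig (Fin n) | openEdgeCluster ω o ∈ U} ∩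
        {ω | j + 1 ≤ (A.filter fun z => ω ∈ openConn o z).card ∧ ω ∉ openConn o c}) := by
  set μ := prodBernoulli w with hμ
  have hmeas : ∀ s : Set (BondConfig (Fin n)), MeasurableSet s := fun _ => MeasurableSet.of_discrete
  -- notation
  set U' : Set (BondConfig (Fin n)) := {ω | openEdgeCluster ω o ∈ U} with hU'
  set Q : Set (BondConfig (Fin n)) := {ω | j + 1 ≤ (A.filter fun z => ω ∈ openConn c z).card} with hQ
  set Dx : Fin n → Set (BondConfig (Fin n)) := fun x =>
    {ω | ∀ s ∈ ({x} : Finset (Fin n)), ∀ u ∈ A \ {x}, ω ∉ openConn s u} with hDx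
  set src : Fin n → Set (BondConfig (Fin n)) := fun x =>
    (openConn o x : Set (BondConfig (Fin n))) ∩ {ω | openEdgeCluster ω x ∈ U} ∩ Dx x ∩ Q with hsrc
  set β : Fin n → ℝ := fun x => μ.real (Dx x ∩ Q) with hβ
  set JT : Finset (Fin n) → Set (BondConfig (Fin n)) := fun T =>
    {ω | ∀ t ∈ T, ∀ t' ∈ T, ω ∈ openConn t t'} with hJT
  set DT : Finset (Fin n) → Set (BondConfig (Fin n)) := fun T =>
    {ω | ∀ s ∈ T, ∀ u ∈ A \ T, ω ∉ openConn s u} with hDT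
  set ET : Finset (Fin n) → Set (BondConfig (Fin n)) := fun T => {ω | ∃ t ∈ T, ω ∈ openConn o t} with hET
  set H : Finset (Fin n) → ℝ := fun T => μ.real (JT T ∩ DT T) with hH
  set tgt : Finset (Fin n) → ℝ := fun T => μ.real ((ET T ∩ U') ∩ (JT T ∩ DT T)) with htgt
  set 𝒯 : Finset (Finset (Fin n)) := (A.erase c).powerset.filter fun T => j + 1 ≤ T.card with h𝒯
  have h𝒯mem : ∀ {T}, T ∈ 𝒯 ↔ T ⊆ A.erase c ∧ j + 1 ≤ T.card := by
    intro T; rw [h𝒯, Finset.mem_filter, Finset.mem_powerset]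
  have hsrc_sub : ∀ x, src x ⊆ Dx x ∩ Q := fun x ω hω => ⟨hω.1.2, hω.2⟩
  have hβ0 : ∀ x, 0 ≤ β x := fun x => measureReal_nonneg
  have hH0 : ∀ T, 0 ≤ H T := fun T => measureReal_nonneg
  -- (i) the left event is covered by the sources `src x`, `x ∈ A ∖ c`
  have hL : μ.real (U' ∩ {ω : BondConfig (Fin n) |
      (A.filter fun z => ω ∈ openConn o z).card = 1 ∧ j + 1 ≤ (A.filter fun z => ω ∈ openConn c z).card}) ≤
      ∑ x ∈ A.erase c, μ.real (src x) := by
    refine (measureReal_mono ?_ (measure_ne_top _ _)).trans (measureReal_biUnion_finset_le (μ := μ) (A.erase c) src)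
    rintro ω ⟨hωU, h1, hbig⟩
    obtain ⟨x, hx⟩ := Finset.card_eq_one.1 h1
    have hxmem : x ∈ A.filter fun z => ω ∈ (openConn o z : Set (BondConfig (Fin n))) := by
      rw [hx]; exact Finset.mem_singleton_self x
    obtain ⟨hxA, hox⟩ := Finset.mem_filter.1 hxmem
    have hox' : (openGraph ω).Reachable o x := hox
    have honly : ∀ z ∈ A, (openGraph ω).Reachable o z → z = x := by
      intro z hzA hoz
      have : z ∈ A.filter fun z => ω ∈ (openConn o z : Set (BondConfig (Fin n))) := Finset.mem_filter.2 ⟨hzA, hoz⟩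
      rw [hx] at this
      exact Finset.mem_singleton.1 this
    have hxc : x ≠ c := by
      rintro rfl
      have hsub : (A.filter fun z => ω ∈ (openConn x z : Set (BondConfig (Fin n)))) ⊆ {x} := by
        intro z hz
        obtain ⟨hzA, hxz⟩ := Finset.mem_filter.1 hz
        have hxz' : (openGraph ω).Reachable x z := hxz
        exact Finset.mem_singleton.2 (honly z hzA (hox'.trans hxz'))
      have := (Finset.card_le_card hsub).trans_eq (Finset.card_singleton x)
      change j + 1 ≤ (A.filter fun z => ω ∈ (openConn x z : Set (BondConfig (Fin n)))).card at hbig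
      omega
    have hCx : openEdgeCluster ω x ∈ U := by
      rw [← exS1_openEdgeCluster_eq_of_conn hox]; exact hωU
    refine Set.mem_iUnion₂.2 ⟨x, Finset.mem_erase.2 ⟨hxc, hxA⟩, ⟨⟨⟨hox, hCx⟩, ?_⟩, hbig⟩⟩
    intro b hb a ha hba
    rw [Finset.mem_singleton] at hb
    subst hb
    obtain ⟨haA, hax⟩ := Finset.mem_sdiff.1 ha
    have hba' : (openGraph ω).Reachable b a := hba
    exact (Finset.notMem_singleton.1 hax) (honly a haA (hox'.trans hba'))
  -- (ii) coverage of each source by the champion inequality: `β x ≤ Σ_{T ∈ 𝒯, x ∈ T} H T`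
  have hcov : ∀ x ∈ A.erase c, β x ≤ ∑ T ∈ 𝒯.filter (fun T => x ∈ T), H T := by
    intro x hx
    obtain ⟨hxc, hxA⟩ := Finset.mem_erase.1 hx
    set Rx : Set (BondConfig (Fin n)) := {ω | (A.filter fun z => ω ∈ openConn x z).card ≤ j} with hRx
    set Rc : Set (BondConfig (Fin n)) := {ω | (A.filter fun z => ω ∈ openConn c z).card ≤ j} with hRc
    have h1 : β x ≤ μ.real (Rx \ Rc) := by
      refine measureReal_mono fun ω hω => ?_
      obtain ⟨hD, hq⟩ := hω
      constructor
      · change (A.filter fun z => ω ∈ (openConn x z : Set (BondConfig (Fin n)))).card ≤ j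
        have hsub : (A.filter fun z => ω ∈ (openConn x z : Set (BondConfig (Fin n)))) ⊆ {x} := by
          intro z hz
          obtain ⟨hzA, hxz⟩ := Finset.mem_filter.1 hz
          by_contra hzx
          exact hD x (Finset.mem_singleton_self x) z (Finset.mem_sdiff.2 ⟨hzA, hzx⟩) hxz
        exact ((Finset.card_le_card hsub).trans_eq (Finset.card_singleton x)).trans hj
      · change ¬ ((A.filter fun z => ω ∈ (openConn c z : Set (BondConfig (Fin n)))).card ≤ j)
        change j + 1 ≤ (A.filter fun z => ω ∈ (openConn c z : Set (BondConfig (Fin n)))).card at hq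
        omega
    have h2 : μ.real (Rx \ Rc) ≤ μ.real (Rc \ Rx) := by
      have e1 := measureReal_inter_add_sdiff (μ := μ) (s := Rx) (hmeas Rc)
      have e2 := measureReal_inter_add_sdiff (μ := μ) (s := Rc) (hmeas Rx)
      rw [Set.inter_comm] at e2
      linarith [hmax x hxA]
    have h3 : μ.real (Rc \ Rx) ≤ ∑ T ∈ 𝒯.filter (fun T => x ∈ T), H T := by
      refine (measureReal_mono ?_ (measure_ne_top _ _)).trans
        (measureReal_biUnion_finset_le (μ := μ) (𝒯.filter fun T => x ∈ T) (fun T => JT T ∩ DT T))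
      rintro ω ⟨hcs, hxb⟩
      change (A.filter fun z => ω ∈ (openConn c z : Set (BondConfig (Fin n)))).card ≤ j at hcs
      change ¬ ((A.filter fun z => ω ∈ (openConn x z : Set (BondConfig (Fin n)))).card ≤ j) at hxb
      set T := A.filter fun z => ω ∈ (openConn x z : Set (BondConfig (Fin n))) with hT
      have hxT : x ∈ T := Finset.mem_filter.2 ⟨hxA, (SimpleGraph.Reachable.refl x : (openGraph ω).Reachable x x)⟩
      have hxc' : ω ∉ (openConn x c : Set (BondConfig (Fin n))) := by
        intro hxc''
        have hxcR : (openGraph ω).Reachable x c := hxc''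
        have heq : T = A.filter fun z => ω ∈ (openConn c z : Set (BondConfig (Fin n))) := by
          refine Finset.filter_congr fun z _ => ⟨fun h => ?_, fun h => ?_⟩
          · exact hxcR.symm.trans h
          · exact hxcR.trans h
        rw [← heq] at hcs
        exact hxb hcs
      have hTmem : T ∈ 𝒯.filter fun T => x ∈ T := by
        refine Finset.mem_filter.2 ⟨h𝒯mem.2 ⟨fun z hz => ?_, by omega⟩, hxT⟩
        obtain ⟨hzA, hxz⟩ := Finset.mem_filter.1 hz
        refine Finset.mem_erase.2 ⟨?_, hzA⟩
        rintro rfl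
        exact hxc' hxz
      refine Set.mem_iUnion₂.2 ⟨T, hTmem, ?_, ?_⟩
      · intro t ht t' ht'
        have h1' : (openGraph ω).Reachable x t := (Finset.mem_filter.1 ht).2
        have h2' : (openGraph ω).Reachable x t' := (Finset.mem_filter.1 ht').2
        exact h1'.symm.trans h2'
      · intro t ht a ha hta
        obtain ⟨haA, haT⟩ := Finset.mem_sdiff.1 ha
        have h1' : (openGraph ω).Reachable x t := (Finset.mem_filter.1 ht).2
        have hta' : (openGraph ω).Reachable t a := hta
        exact haT (Finset.mem_filter.2 ⟨haA, h1'.trans hta'⟩)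
    exact h1.trans (h2.trans h3)
  -- (iii) the packing row of each big target `T ⊆ A ∖ c` (with the up-set)
  have hrow : ∀ T ∈ 𝒯, (∑ x ∈ T, μ.real (src x) / β x) * H T ≤ tgt T := by
    intro T hT
    obtain ⟨hTsub, _⟩ := h𝒯mem.1 hT
    have hTA : T ⊆ A := hTsub.trans (Finset.erase_subset c A)
    have hcT : c ∈ A \ T := Finset.mem_sdiff.2 ⟨hc, fun h => (Finset.mem_erase.1 (hTsub h)).1 rfl⟩
    exact packing_upset w A T hTA o c j hcT U hU T (subset_refl T) β (fun x _ => hβ0 x) (fun x _ => le_refl _)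
  -- (iv) the target atoms are disjoint pieces of the right event
  have hR : ∑ T ∈ 𝒯, tgt T ≤ μ.real (U' ∩ {ω : BondConfig (Fin n) |
      j + 1 ≤ (A.filter fun z => ω ∈ openConn o z).card ∧ ω ∉ openConn o c}) := by
    have hdisj : (↑𝒯 : Set (Finset (Fin n))).PairwiseDisjoint fun T => (ET T ∩ U') ∩ (JT T ∩ DT T) := by
      intro T hT T' hT' hne
      rw [Function.onFun, Set.disjoint_left]
      rintro ω ⟨⟨⟨t, ht, hot⟩, _⟩, hJ, hD⟩ ⟨⟨⟨t', ht', hot'⟩, _⟩, hJ', hD'⟩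
      have hTA : T ⊆ A := (h𝒯mem.1 hT).1.trans (Finset.erase_subset c A)
      have hTA' : T' ⊆ A := (h𝒯mem.1 hT').1.trans (Finset.erase_subset c A)
      have hot1 : (openGraph ω).Reachable o t := hot
      have hot2 : (openGraph ω).Reachable o t' := hot'
      have ht'T : t' ∈ T := by
        by_contra h
        exact hD t ht t' (Finset.mem_sdiff.2 ⟨hTA' ht', h⟩) (hot1.symm.trans hot2)
      have e1 := filter_eq_of_block hTA ht'T hJ hD
      have e2 := filter_eq_of_block hTA' ht' hJ' hD'
      exact hne (e1.symm.trans e2)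
    rw [← measureReal_biUnion_finset hdisj fun T _ => hmeas _]
    refine measureReal_mono (Set.iUnion₂_subset fun T hT => ?_)
    rintro ω ⟨⟨⟨t, ht, hot⟩, hωU⟩, hJ, hD⟩
    obtain ⟨hTsub, hTcard⟩ := h𝒯mem.1 hT
    have hTA : T ⊆ A := hTsub.trans (Finset.erase_subset c A)
    have hot' : (openGraph ω).Reachable o t := hot
    have hπo : (A.filter fun z => ω ∈ (openConn o z : Set (BondConfig (Fin n)))) = T := by
      rw [← filter_eq_of_block hTA ht hJ hD]
      refine Finset.filter_congr fun z _ => ⟨fun h => ?_, fun h => ?_⟩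
      · exact hot'.symm.trans h
      · exact hot'.trans h
    refine ⟨hωU, by rw [hπo]; exact hTcard, fun hoc => ?_⟩
    have hcT : c ∈ T := by
      rw [← hπo]; exact Finset.mem_filter.2 ⟨hc, hoc⟩
    exact (Finset.mem_erase.1 (hTsub hcT)).1 rfl
  -- (v) assembly
  have hstep : ∀ x ∈ A.erase c, μ.real (src x) ≤
      (μ.real (src x) / β x) * ∑ T ∈ 𝒯.filter (fun T => x ∈ T), H T := by
    intro x hx
    rcases (hβ0 x).eq_or_lt with h0 | hpos
    · have : μ.real (src x) = 0 :=
        le_antisymm ((measureReal_mono (hsrc_sub x)).trans_eq h0.symm) measureReal_nonneg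
      rw [this, zero_div, zero_mul]
    · calc μ.real (src x) = μ.real (src x) / β x * β x := by field_simp
        _ ≤ μ.real (src x) / β x * ∑ T ∈ 𝒯.filter (fun T => x ∈ T), H T :=
            mul_le_mul_of_nonneg_left (hcov x hx) (div_nonneg measureReal_nonneg (hβ0 x))
  have hswap : ∑ x ∈ A.erase c, (μ.real (src x) / β x) * ∑ T ∈ 𝒯.filter (fun T => x ∈ T), H T =
      ∑ T ∈ 𝒯, (∑ x ∈ T, μ.real (src x) / β x) * H T := by
    simp_rw [Finset.mul_sum, Finset.sum_mul]
    refine Finset.sum_comm' fun x T => ⟨fun ⟨hx, hT⟩ => ?_, fun ⟨hxT, hT⟩ => ?_⟩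
    · obtain ⟨hT𝒯, hxT⟩ := Finset.mem_filter.1 hT
      exact ⟨hxT, hT𝒯⟩
    · exact ⟨(h𝒯mem.1 hT).1 hxT, Finset.mem_filter.2 ⟨hT, hxT⟩⟩
  calc μ.real (U' ∩ {ω : BondConfig (Fin n) |
        (A.filter fun z => ω ∈ openConn o z).card = 1 ∧ j + 1 ≤ (A.filter fun z => ω ∈ openConn c z).card})
      ≤ ∑ x ∈ A.erase c, μ.real (src x) := hL
    _ ≤ ∑ x ∈ A.erase c, (μ.real (src x) / β x) * ∑ T ∈ 𝒯.filter (fun T => x ∈ T), H T :=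
        Finset.sum_le_sum hstep
    _ = ∑ T ∈ 𝒯, (∑ x ∈ T, μ.real (src x) / β x) * H T := hswap
    _ ≤ ∑ T ∈ 𝒯, tgt T := Finset.sum_le_sum hrow
    _ ≤ μ.real (U' ∩ {ω : BondConfig (Fin n) |
        j + 1 ≤ (A.filter fun z => ω ∈ openConn o z).card ∧ ω ∉ openConn o c}) := hR


end Summit.CriticalPhenomena.PercolationContinuityZ3.Theorems

end
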